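import Summits.Langlands.Langlands.Theses.FrobeniusUnitCarving

/-!
# Route FrobeniusUnitCarving — Assembly

The assembly item (stmt-Langlands-27436) of the child route `FrobeniusUnitCarving` (decomp-langlands lens-6 gen 33; refining child
`--refines route-Langlands-PrimeSwitchSplit:WeakGeometricAutomorphy`, the 95th cell route, thaw slot 6) for B_w = `PrimeSwitchSplit.WeakGeometricAutomorphy` (stmt-Langlands-17414):
`FrobeniusUnits → UnitWeakAutomorphy → Summit.Langlands.Langlands.Theses.PrimeSwitchSplit.WeakGeometricAutomorphy`.

This is literally the type of the route file's sorry-free deciding theorem `Summit.Langlands.Langlands.Theses.FrobeniusUnitCarving.closes`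
(one-line seam: the unit clause FU is fed into UWA).
Nothing here proves `Langlands` (nor the parent piece): the assembly records only that the items of the route, taken together, imply the parent piece
by name.
-/

set_option linter.dupNamespace false -- project-wide option (lakefile weak.linter.dupNamespace); `Summit.Langlands.Langlands` is the mandated namespace

namespace Summit.Langlands.Langlands.Theorems

/-- **Assembly of route FrobeniusUnitCarving** (stmt-Langlands-27436):
`FrobeniusUnits → UnitWeakAutomorphy → Summit.Langlands.Langlands.Theses.PrimeSwitchSplit.WeakGeometricAutomorphy`.
Proof: unfold `Assembly` and apply the route's deciding theorem `Theses.FrobeniusUnitCarving.closes`. -/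
theorem frobeniusUnitCarving_assembly_proof :
    Summit.Langlands.Langlands.Theses.FrobeniusUnitCarving.Assembly := by
  unfold Summit.Langlands.Langlands.Theses.FrobeniusUnitCarving.Assembly
  exact Summit.Langlands.Langlands.Theses.FrobeniusUnitCarving.closes

end Summit.Langlands.Langlands.Theorems
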